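import Literature.Geometry.Kaehler.ComplexTorusCyclotomicAutomorphismOrderNine
import Literature.NumberTheory.NumberFields.CyclotomicFieldsSevenNineClassNumber
import HarnessLib

/-!
# Exactly two complex tori of dimension `3` admit an automorphism of order `7` (resp. `9`) — unconditionally:
# the class numbers `h(ℚ(ζ_7)) = h(ℚ(ζ_9)) = 1` discharge the principal-ideal-ring hypothesis of FILES 4, 5

Layer `Literature/Geometry/Kaehler`, namespace `Literature.Geometry.Kaehler.ComplexTorus`; lane `lit-hodgefound`
(Track 2 foundations library), Layer A2/A3 junction, row «A2-26(gk)» (self-proposed 2026-08-28, prover seat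
`lit-hodgefound-p10`, generation 32, FILE 7 of the generation).  Theorems only; no `def`, no instance, no named
fact (net Literature debt 0).

Generation 32 FILES 4 and 5 (`…OrderSeven`, `…OrderNine`) classify the `3`-dimensional complex tori `X` carrying an
endomorphism `u` of order `7` (resp. `9`) «read through a model `K` of `ℚ(ζ)` with `𝓞_K` principal»: two such tori are
isomorphic iff both are simple or both are not.  FILE 2 of the generation (`CyclotomicFieldsSevenNineClassNumber`)
proves `h(ℚ(ζ_7)) = h(ℚ(ζ_9)) = 1` (Minkowski's bound with Marcus' Theorem 26; Masley–Montgomery's list), so the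
hypothesis is void.  This file states the classification UNCONDITIONALLY and in its sharp «exactly two» form:

* §1 (`ℚ(ζ_7)`), for every `7`-th cyclotomic extension `K/ℚ`, all CM types `Φ, Ψ` and ALL fractional ideals
  `𝔞, 𝔟`: **`ℂ³/Φ(𝔞) ≅ ℂ³/Ψ(𝔟)` iff both are simple or both are not, iff `Φ, Ψ` are both primitive or both
  imprimitive** (`isIsomorphic_periodIso_iff_isSimple_iff_seven`, `…_iff_isPrimitive_iff_seven`); for complex tori:
  **two `3`-tori with endomorphisms of order `7` (or `14`) are isomorphic iff both are simple or both are not**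
  (`isIsomorphic_iff_isSimple_iff_of_orderOf_eq_seven`, `…_seven_or_fourteen`), all simple ones are isomorphic
  (`IsSimple.isIsomorphic_of_orderOf_eq_seven_or_fourteen'`), and **THE CLASSIFICATION: there are two models
  `X₁ = ℂ³/Φ₁(𝓞)` (simple) and `X₂ = ℂ³/Φ₂(𝓞)` (non-simple, `∼ E³`) over `ℚ(ζ_7) = CyclotomicField 7 ℚ`,
  non-isomorphic, such that EVERY `3`-dimensional complex torus with an endomorphism of order `7` is isomorphic to
  `X₁` or to `X₂`** (`exists_pair_forall_isIsomorphic_of_orderOf_eq_seven`).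
* §2 (`ℚ(ζ_9)`): the same for the orders `9` and `18`.

These are the `g = 3` entries `ζ_7`, `ζ_9` of Birkenhake–Lange's table of abelian varieties of dimension `g` with an
automorphism of order `d`, `φ(d) = 2g` («`X ≅ ℂ^g/Φ(𝔞)` … the number of isomorphism classes is … `h` times the
number of types up to automorphisms»), made explicit: `h = 1` and two families of types each.

## References

* [Shimura1998] G. Shimura, *Abelian Varieties with Complex Multiplication and Modular Functions* (1998), §6.1
  Thm. 2 p. 41, §7.4 Prop. 17 p. 58, §8.2 Prop. 26 p. 69, §8.4 Example (1) p. 65.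
* [BirkenhakeLange2004] Ch. Birkenhake, H. Lange, *Complex Abelian Varieties*, 2nd ed. (2004), §13.3 (abelian
  varieties with an automorphism of order `d`, `φ(d) = 2g`; Cor. 13.3.4–13.3.6).
* [Marcus2018] D. A. Marcus, *Number Fields*, 2nd ed. (2018), Ch. 5 Exercise 17 (`ℤ[ζ_7]` is a PID).
* [Washington1997] L. C. Washington, *Introduction to Cyclotomic Fields*, 2nd ed. (1997), Thm. 11.1.
-/

noncomputable section

open scoped Classical nonZeroDivisors NumberField Manifold ContDiff
open NumberField Module Polynomial

namespace Literature.Geometry.Kaehler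

namespace ComplexTorus

open scoped Literature.NumberTheory.ComplexMultiplication
open Literature.AlgebraicGeometry.Motives (CMType)
open Literature.NumberTheory.ComplexMultiplication.CMTypeLattice (periodIso isSimple_periodIso_iff_isPrimitive)
open Literature.NumberTheory.NumberFields (classNumber_eq_one_of_isCyclotomicExtension_seven
  classNumber_eq_one_of_isCyclotomicExtension_nine isPrincipalIdealRing_ringOfIntegers_cyclotomicField_seven
  isPrincipalIdealRing_ringOfIntegers_cyclotomicField_nine)
open Literature.NumberTheory.ComplexMultiplication (CMTypeLattice.mulMatrix)

/-! ### §1 `ℚ(ζ_7)`: the models for all ideals, the tori, the two-element classification -/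

section ModelsSeven

variable {K : Type} [Field K] [NumberField K] [IsCyclotomicExtension {7} ℚ K]

variable (K) in
/-- `𝓞_K` is principal for a `7`-th cyclotomic extension — `h(ℚ(ζ_7)) = 1` (FILE 2). [cite: Marcus2018, Ch. 5 Exercise 17]
[cite: Washington1997, Thm. 11.1] -/
private theorem isPrincipalIdealRing_seven : IsPrincipalIdealRing (𝓞 K) :=
  (classNumber_eq_one_iff (K := K)).1 (classNumber_eq_one_of_isCyclotomicExtension_seven K inferInstance)

/-- `dim_ℂ ℂ^Φ = 3` for a CM type `Φ` of `ℚ(ζ_7)`. [cite: Shimura1998, §6.2 Thm. 3, p. 42] -/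
private theorem finrank_pi_cmType_seven' (Φ : CMType K) : finrank ℂ (Φ.1 → ℂ) = 3 := by
  have h := two_mul_finrank_pi_cmType (d := 7) (K := K) Φ
  rw [Nat.totient_prime Nat.prime_seven] at h
  omega

/-- **THE MODELS `ℂ³/Φ(𝔞)` OF `ℚ(ζ_7)` ARE TWO TORI — ALL TYPES, ALL IDEALS, NO HYPOTHESIS**: `ℂ³/Φ(𝔞) ≅ ℂ³/Ψ(𝔟)` as
complex tori iff both are simple or both are non-simple (`h(ℚ(ζ_7)) = 1`: every `𝔞` is principal, and FILE 4's
classification of the pairs `(ℂ³/Φ(𝔞), ζ_7)`). [cite: Shimura1998, §7.4 Prop. 17 p. 58, §8.2 Prop. 26 p. 69, §8.4 Example (1) p. 65]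
[cite: BirkenhakeLange2004, §13.3] [cite: Washington1997, Thm. 11.1] -/
theorem isIsomorphic_periodIso_iff_isSimple_iff_seven (Φ Ψ : CMType K) (I J : (FractionalIdeal (𝓞 K)⁰ K)ˣ) :
    IsIsomorphic (periodIso Φ I) (periodIso Ψ J) ↔
      (ComplexTorus.IsSimple (periodIso Φ I) ↔ ComplexTorus.IsSimple (periodIso Ψ J)) := by
  haveI := isPrincipalIdealRing_seven K
  obtain ⟨ζ, hζ⟩ : ∃ ζ : K, IsPrimitiveRoot ζ 7 :=
    IsCyclotomicExtension.exists_isPrimitiveRoot ℚ K (Set.mem_singleton 7) (by norm_num)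
  exact isIsomorphic_iff_of_orderOf_eq_seven K (mulMatrix_toInteger_mem_endRingInt hζ Φ I)
    (orderOf_mulMatrix_toInteger hζ Φ I) (finrank_pi_cmType_seven' Φ) (mulMatrix_toInteger_mem_endRingInt hζ Ψ J)
    (orderOf_mulMatrix_toInteger hζ Ψ J) (finrank_pi_cmType_seven' Ψ)

/-- **… iff `Φ` and `Ψ` are both primitive or both imprimitive** (Prop. 26: simple ⟺ primitive).
[cite: Shimura1998, §8.2 Prop. 26 p. 69, §8.4 Example (1) p. 65] [cite: BirkenhakeLange2004, §13.3] -/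
theorem isIsomorphic_periodIso_iff_isPrimitive_iff_seven (Φ Ψ : CMType K) (I J : (FractionalIdeal (𝓞 K)⁰ K)ˣ)
    (φ₀ : K →+* ℂ) :
    IsIsomorphic (periodIso Φ I) (periodIso Ψ J) ↔
      (Literature.NumberTheory.ComplexMultiplication.IsPrimitive (ℂ ≃+* ℂ) Φ.1 φ₀ ↔
        Literature.NumberTheory.ComplexMultiplication.IsPrimitive (ℂ ≃+* ℂ) Ψ.1 φ₀) := by
  rw [isIsomorphic_periodIso_iff_isSimple_iff_seven, isSimple_periodIso_iff_isPrimitive Φ I φ₀,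
    isSimple_periodIso_iff_isPrimitive Ψ J φ₀]

/-- **All simple models `ℂ³/Φ(𝔞)` of `ℚ(ζ_7)` are isomorphic** (one simple `ζ_7`-threefold).
[cite: Shimura1998, §7.4 Prop. 17 p. 58, §8.4 Example (1) p. 65] [cite: BirkenhakeLange2004, §13.3] -/
theorem isIsomorphic_periodIso_of_isSimple_seven {Φ Ψ : CMType K} {I J : (FractionalIdeal (𝓞 K)⁰ K)ˣ}
    (hΦ : ComplexTorus.IsSimple (periodIso Φ I)) (hΨ : ComplexTorus.IsSimple (periodIso Ψ J)) :
    IsIsomorphic (periodIso Φ I) (periodIso Ψ J) :=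
  (isIsomorphic_periodIso_iff_isSimple_iff_seven Φ Ψ I J).2 (iff_of_true hΦ hΨ)

/-- **All non-simple models `ℂ³/Φ(𝔞)` of `ℚ(ζ_7)` are isomorphic** (one non-simple `ζ_7`-threefold, `∼ E³`).
[cite: Shimura1998, §7.4 Prop. 17 p. 58, §8.4 Example (1) p. 65] [cite: BirkenhakeLange2004, §13.3] -/
theorem isIsomorphic_periodIso_of_not_isSimple_seven {Φ Ψ : CMType K} {I J : (FractionalIdeal (𝓞 K)⁰ K)ˣ}
    (hΦ : ¬ ComplexTorus.IsSimple (periodIso Φ I)) (hΨ : ¬ ComplexTorus.IsSimple (periodIso Ψ J)) :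
    IsIsomorphic (periodIso Φ I) (periodIso Ψ J) :=
  (isIsomorphic_periodIso_iff_isSimple_iff_seven Φ Ψ I J).2 (iff_of_false hΦ hΨ)

end ModelsSeven

section Seven

variable {ι : Type} [Fintype ι] [DecidableEq ι] {E : Type} [NormedAddCommGroup E] [NormedSpace ℂ E]
  {P : (ι → ℝ) ≃L[ℝ] E} {ι' : Type} [Fintype ι'] [DecidableEq ι'] {E' : Type} [NormedAddCommGroup E']
  [NormedSpace ℂ E'] {P' : (ι' → ℝ) ≃L[ℝ] E'}

set_option backward.isDefEq.respectTransparency false in -- Mathlib's instance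
-- `IsCyclotomicExtension {7} ℚ (CyclotomicField 7 ℚ)` is keyed on `CyclotomicField.algebra`, the goal on
-- `DivisionRing.toRatAlgebra` (same workaround as generation 31 FILE 1 `isAbelianVariety_of_charpoly_eq_cyclotomic`)
/-- **TWO `3`-DIMENSIONAL COMPLEX TORI WITH ENDOMORPHISMS OF ORDER `7` ARE ISOMORPHIC IFF BOTH ARE SIMPLE OR BOTH ARE
NOT** — unconditionally (`h(ℚ(ζ_7)) = 1`). [cite: Shimura1998, §7.4 Prop. 17 p. 58, §8.2 Prop. 26 p. 69, §8.4 Example (1) p. 65]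
[cite: BirkenhakeLange2004, §13.3] [cite: Washington1997, Thm. 11.1] -/
theorem isIsomorphic_iff_isSimple_iff_of_orderOf_eq_seven {A : Matrix ι ι ℤ} (hA : A ∈ endRingInt P)
    (hord : orderOf A = 7) (hdim : finrank ℂ E = 3) {A' : Matrix ι' ι' ℤ} (hA' : A' ∈ endRingInt P')
    (hord' : orderOf A' = 7) (hdim' : finrank ℂ E' = 3) :
    IsIsomorphic P P' ↔ (ComplexTorus.IsSimple P ↔ ComplexTorus.IsSimple P') :=
  haveI := isPrincipalIdealRing_ringOfIntegers_cyclotomicField_seven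
  isIsomorphic_iff_of_orderOf_eq_seven (CyclotomicField 7 ℚ) hA hord hdim hA' hord' hdim'

set_option backward.isDefEq.respectTransparency false in -- see above
/-- **… also for the orders `7` and `14` together** (`−u` has order `7` when `u` has order `14`).
[cite: Shimura1998, §7.4 Prop. 17 p. 58, §8.4 Example (1) p. 65] [cite: BirkenhakeLange2004, §13.3] -/
theorem isIsomorphic_iff_isSimple_iff_of_orderOf_eq_seven_or_fourteen {A : Matrix ι ι ℤ} (hA : A ∈ endRingInt P)
    (hord : orderOf A = 7 ∨ orderOf A = 14) (hdim : finrank ℂ E = 3) {A' : Matrix ι' ι' ℤ} (hA' : A' ∈ endRingInt P')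
    (hord' : orderOf A' = 7 ∨ orderOf A' = 14) (hdim' : finrank ℂ E' = 3) :
    IsIsomorphic P P' ↔ (ComplexTorus.IsSimple P ↔ ComplexTorus.IsSimple P') :=
  haveI := isPrincipalIdealRing_ringOfIntegers_cyclotomicField_seven
  isIsomorphic_iff_of_orderOf_eq_seven_or_fourteen (K := CyclotomicField 7 ℚ) hA hord hdim hA' hord' hdim'

set_option backward.isDefEq.respectTransparency false in -- see above
/-- **THERE IS ONE SIMPLE `3`-DIMENSIONAL COMPLEX TORUS WITH AN AUTOMORPHISM OF ORDER `7` OR `14`** (the simple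
`ζ_7`-threefold): any two are isomorphic — unconditionally. [cite: Shimura1998, §7.4 Prop. 17 p. 58, §8.4 Example (1) p. 65]
[cite: BirkenhakeLange2004, §13.3] [cite: Washington1997, Thm. 11.1] -/
theorem IsSimple.isIsomorphic_of_orderOf_eq_seven_or_fourteen' (hX : ComplexTorus.IsSimple P) {A : Matrix ι ι ℤ}
    (hA : A ∈ endRingInt P) (hord : orderOf A = 7 ∨ orderOf A = 14) (hdim : finrank ℂ E = 3)
    (hX' : ComplexTorus.IsSimple P') {A' : Matrix ι' ι' ℤ} (hA' : A' ∈ endRingInt P')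
    (hord' : orderOf A' = 7 ∨ orderOf A' = 14) (hdim' : finrank ℂ E' = 3) : IsIsomorphic P P' :=
  haveI := isPrincipalIdealRing_ringOfIntegers_cyclotomicField_seven
  hX.isIsomorphic_of_orderOf_eq_seven_or_fourteen (K := CyclotomicField 7 ℚ) hA hord hdim hX' hA' hord' hdim'

set_option backward.isDefEq.respectTransparency false in -- see above
/-- **All non-simple `3`-dimensional complex tori with an automorphism of order `7` or `14` are isomorphic** (the
threefold `∼ E³`) — unconditionally. [cite: Shimura1998, §7.4 Prop. 17 p. 58, §8.4 Example (1) p. 65] [cite: BirkenhakeLange2004, §13.3] -/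
theorem isIsomorphic_of_not_isSimple_of_orderOf_eq_seven_or_fourteen (hX : ¬ ComplexTorus.IsSimple P)
    {A : Matrix ι ι ℤ} (hA : A ∈ endRingInt P) (hord : orderOf A = 7 ∨ orderOf A = 14) (hdim : finrank ℂ E = 3)
    (hX' : ¬ ComplexTorus.IsSimple P') {A' : Matrix ι' ι' ℤ} (hA' : A' ∈ endRingInt P')
    (hord' : orderOf A' = 7 ∨ orderOf A' = 14) (hdim' : finrank ℂ E' = 3) : IsIsomorphic P P' :=
  (isIsomorphic_iff_isSimple_iff_of_orderOf_eq_seven_or_fourteen hA hord hdim hA' hord' hdim').2 (iff_of_false hX hX')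

set_option backward.isDefEq.respectTransparency false in -- see above
/-- **EXACTLY TWO COMPLEX TORI OF DIMENSION `3` ADMIT AN AUTOMORPHISM OF ORDER `7`.**  There are CM types `Φ₁, Φ₂`
of `ℚ(ζ_7)` (here Mathlib's `CyclotomicField 7 ℚ`) with `X₁ = ℂ³/Φ₁(𝓞)` simple and `X₂ = ℂ³/Φ₂(𝓞)` non-simple —
hence `X₁ ≇ X₂` — such that EVERY `3`-dimensional complex torus carrying an endomorphism of order `7` is isomorphic
to `X₁` or to `X₂` (both carry the automorphism `ζ_7` of order `7`, FILE 8 of generation 31).  Birkenhake–Lange's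
count «`h(ℚ(ζ_d))` times the number of types modulo automorphisms» at `d = 7`: `1 · 2`.
[cite: BirkenhakeLange2004, §13.3] [cite: Shimura1998, §6.1 Thm. 2 p. 41, §7.4 Prop. 17 p. 58, §8.4 Example (1) p. 65]
[cite: Washington1997, Thm. 11.1] -/
theorem exists_pair_forall_isIsomorphic_of_orderOf_eq_seven :
    ∃ Φ₁ Φ₂ : CMType (CyclotomicField 7 ℚ),
      ComplexTorus.IsSimple (periodIso Φ₁ (1 : (FractionalIdeal (𝓞 (CyclotomicField 7 ℚ))⁰ (CyclotomicField 7 ℚ))ˣ)) ∧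
      ¬ ComplexTorus.IsSimple (periodIso Φ₂ (1 : (FractionalIdeal (𝓞 (CyclotomicField 7 ℚ))⁰ (CyclotomicField 7 ℚ))ˣ)) ∧
      ¬ IsIsomorphic (periodIso Φ₁ (1 : (FractionalIdeal (𝓞 (CyclotomicField 7 ℚ))⁰ (CyclotomicField 7 ℚ))ˣ))
          (periodIso Φ₂ (1 : (FractionalIdeal (𝓞 (CyclotomicField 7 ℚ))⁰ (CyclotomicField 7 ℚ))ˣ)) ∧
      ∀ {ι : Type} [Fintype ι] [DecidableEq ι] {E : Type} [NormedAddCommGroup E] [NormedSpace ℂ E]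
        (P : (ι → ℝ) ≃L[ℝ] E) {A : Matrix ι ι ℤ}, A ∈ endRingInt P → orderOf A = 7 → finrank ℂ E = 3 →
        IsIsomorphic P (periodIso Φ₁ (1 : (FractionalIdeal (𝓞 (CyclotomicField 7 ℚ))⁰ (CyclotomicField 7 ℚ))ˣ)) ∨
          IsIsomorphic P (periodIso Φ₂ (1 : (FractionalIdeal (𝓞 (CyclotomicField 7 ℚ))⁰ (CyclotomicField 7 ℚ))ˣ)) := by
  haveI := isPrincipalIdealRing_ringOfIntegers_cyclotomicField_seven
  have hζ := IsCyclotomicExtension.zeta_spec 7 ℚ (CyclotomicField 7 ℚ)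
  obtain ⟨Φ₁, h₁⟩ := exists_isSimple_periodIso_seven (K := CyclotomicField 7 ℚ) 1
  obtain ⟨Φ₂, h₂⟩ := exists_not_isSimple_periodIso_seven (K := CyclotomicField 7 ℚ) 1
  refine ⟨Φ₁, Φ₂, h₁, h₂, fun h ↦ h₂ (h.isSimple_iff.1 h₁), fun P A hA hord hdim ↦ ?_⟩
  by_cases hX : ComplexTorus.IsSimple P
  · exact Or.inl (isIsomorphic_periodIso_one_of_orderOf_eq_seven (CyclotomicField 7 ℚ) hζ Φ₁ hA hord hdim
      (iff_of_true hX h₁))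
  · exact Or.inr (isIsomorphic_periodIso_one_of_orderOf_eq_seven (CyclotomicField 7 ℚ) hζ Φ₂ hA hord hdim
      (iff_of_false hX h₂))

end Seven

/-! ### §2 `ℚ(ζ_9)`: the same for the orders `9` and `18` -/

section ModelsNine

variable {K : Type} [Field K] [NumberField K] [IsCyclotomicExtension {9} ℚ K]

variable (K) in
/-- `𝓞_K` is principal for a `9`-th cyclotomic extension — `h(ℚ(ζ_9)) = 1` (FILE 2). [cite: Washington1997, Thm. 11.1] -/
private theorem isPrincipalIdealRing_nine : IsPrincipalIdealRing (𝓞 K) :=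
  (classNumber_eq_one_iff (K := K)).1 (classNumber_eq_one_of_isCyclotomicExtension_nine K inferInstance)

/-- `φ(9) = 6`. [folklore] -/
private theorem totient_nine₃₂'' : Nat.totient 9 = 6 := by decide

/-- `dim_ℂ ℂ^Φ = 3` for a CM type `Φ` of `ℚ(ζ_9)`. [cite: Shimura1998, §6.2 Thm. 3, p. 42] -/
private theorem finrank_pi_cmType_nine' (Φ : CMType K) : finrank ℂ (Φ.1 → ℂ) = 3 := by
  have h := two_mul_finrank_pi_cmType (d := 9) (K := K) Φ
  rw [totient_nine₃₂''] at h
  omega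

/-- **THE MODELS `ℂ³/Φ(𝔞)` OF `ℚ(ζ_9)` ARE TWO TORI — ALL TYPES, ALL IDEALS, NO HYPOTHESIS**: `ℂ³/Φ(𝔞) ≅ ℂ³/Ψ(𝔟)`
iff both are simple or both are non-simple (`h(ℚ(ζ_9)) = 1`). [cite: Shimura1998, §7.4 Prop. 17 p. 58, §8.2 Prop. 26 p. 69, §8.4 Example (1) p. 65]
[cite: BirkenhakeLange2004, §13.3] [cite: Washington1997, Thm. 11.1] -/
theorem isIsomorphic_periodIso_iff_isSimple_iff_nine (Φ Ψ : CMType K) (I J : (FractionalIdeal (𝓞 K)⁰ K)ˣ) :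
    IsIsomorphic (periodIso Φ I) (periodIso Ψ J) ↔
      (ComplexTorus.IsSimple (periodIso Φ I) ↔ ComplexTorus.IsSimple (periodIso Ψ J)) := by
  haveI := isPrincipalIdealRing_nine K
  obtain ⟨ζ, hζ⟩ : ∃ ζ : K, IsPrimitiveRoot ζ 9 :=
    IsCyclotomicExtension.exists_isPrimitiveRoot ℚ K (Set.mem_singleton 9) (by norm_num)
  exact isIsomorphic_iff_of_orderOf_eq_nine K (mulMatrix_toInteger_mem_endRingInt hζ Φ I)
    (orderOf_mulMatrix_toInteger hζ Φ I) (finrank_pi_cmType_nine' Φ) (mulMatrix_toInteger_mem_endRingInt hζ Ψ J)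
    (orderOf_mulMatrix_toInteger hζ Ψ J) (finrank_pi_cmType_nine' Ψ)

/-- **… iff `Φ` and `Ψ` are both primitive or both imprimitive.** [cite: Shimura1998, §8.2 Prop. 26 p. 69, §8.4 Example (1) p. 65]
[cite: BirkenhakeLange2004, §13.3] -/
theorem isIsomorphic_periodIso_iff_isPrimitive_iff_nine (Φ Ψ : CMType K) (I J : (FractionalIdeal (𝓞 K)⁰ K)ˣ)
    (φ₀ : K →+* ℂ) :
    IsIsomorphic (periodIso Φ I) (periodIso Ψ J) ↔
      (Literature.NumberTheory.ComplexMultiplication.IsPrimitive (ℂ ≃+* ℂ) Φ.1 φ₀ ↔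
        Literature.NumberTheory.ComplexMultiplication.IsPrimitive (ℂ ≃+* ℂ) Ψ.1 φ₀) := by
  rw [isIsomorphic_periodIso_iff_isSimple_iff_nine, isSimple_periodIso_iff_isPrimitive Φ I φ₀,
    isSimple_periodIso_iff_isPrimitive Ψ J φ₀]

/-- **All simple models `ℂ³/Φ(𝔞)` of `ℚ(ζ_9)` are isomorphic.** [cite: Shimura1998, §7.4 Prop. 17 p. 58, §8.4 Example (1) p. 65]
[cite: BirkenhakeLange2004, §13.3] -/
theorem isIsomorphic_periodIso_of_isSimple_nine {Φ Ψ : CMType K} {I J : (FractionalIdeal (𝓞 K)⁰ K)ˣ}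
    (hΦ : ComplexTorus.IsSimple (periodIso Φ I)) (hΨ : ComplexTorus.IsSimple (periodIso Ψ J)) :
    IsIsomorphic (periodIso Φ I) (periodIso Ψ J) :=
  (isIsomorphic_periodIso_iff_isSimple_iff_nine Φ Ψ I J).2 (iff_of_true hΦ hΨ)

/-- **All non-simple models `ℂ³/Φ(𝔞)` of `ℚ(ζ_9)` are isomorphic.** [cite: Shimura1998, §7.4 Prop. 17 p. 58, §8.4 Example (1) p. 65]
[cite: BirkenhakeLange2004, §13.3] -/
theorem isIsomorphic_periodIso_of_not_isSimple_nine {Φ Ψ : CMType K} {I J : (FractionalIdeal (𝓞 K)⁰ K)ˣ}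
    (hΦ : ¬ ComplexTorus.IsSimple (periodIso Φ I)) (hΨ : ¬ ComplexTorus.IsSimple (periodIso Ψ J)) :
    IsIsomorphic (periodIso Φ I) (periodIso Ψ J) :=
  (isIsomorphic_periodIso_iff_isSimple_iff_nine Φ Ψ I J).2 (iff_of_false hΦ hΨ)

end ModelsNine

section Nine

variable {ι : Type} [Fintype ι] [DecidableEq ι] {E : Type} [NormedAddCommGroup E] [NormedSpace ℂ E]
  {P : (ι → ℝ) ≃L[ℝ] E} {ι' : Type} [Fintype ι'] [DecidableEq ι'] {E' : Type} [NormedAddCommGroup E']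
  [NormedSpace ℂ E'] {P' : (ι' → ℝ) ≃L[ℝ] E'}

set_option backward.isDefEq.respectTransparency false in -- see §1
/-- **TWO `3`-DIMENSIONAL COMPLEX TORI WITH ENDOMORPHISMS OF ORDER `9` ARE ISOMORPHIC IFF BOTH ARE SIMPLE OR BOTH ARE
NOT** — unconditionally (`h(ℚ(ζ_9)) = 1`). [cite: Shimura1998, §7.4 Prop. 17 p. 58, §8.2 Prop. 26 p. 69, §8.4 Example (1) p. 65]
[cite: BirkenhakeLange2004, §13.3] [cite: Washington1997, Thm. 11.1] -/
theorem isIsomorphic_iff_isSimple_iff_of_orderOf_eq_nine {A : Matrix ι ι ℤ} (hA : A ∈ endRingInt P)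
    (hord : orderOf A = 9) (hdim : finrank ℂ E = 3) {A' : Matrix ι' ι' ℤ} (hA' : A' ∈ endRingInt P')
    (hord' : orderOf A' = 9) (hdim' : finrank ℂ E' = 3) :
    IsIsomorphic P P' ↔ (ComplexTorus.IsSimple P ↔ ComplexTorus.IsSimple P') :=
  haveI := isPrincipalIdealRing_ringOfIntegers_cyclotomicField_nine
  isIsomorphic_iff_of_orderOf_eq_nine (CyclotomicField 9 ℚ) hA hord hdim hA' hord' hdim'

set_option backward.isDefEq.respectTransparency false in -- see §1
/-- **… also for the orders `9` and `18` together.** [cite: Shimura1998, §7.4 Prop. 17 p. 58, §8.4 Example (1) p. 65]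
[cite: BirkenhakeLange2004, §13.3] -/
theorem isIsomorphic_iff_isSimple_iff_of_orderOf_eq_nine_or_eighteen {A : Matrix ι ι ℤ} (hA : A ∈ endRingInt P)
    (hord : orderOf A = 9 ∨ orderOf A = 18) (hdim : finrank ℂ E = 3) {A' : Matrix ι' ι' ℤ} (hA' : A' ∈ endRingInt P')
    (hord' : orderOf A' = 9 ∨ orderOf A' = 18) (hdim' : finrank ℂ E' = 3) :
    IsIsomorphic P P' ↔ (ComplexTorus.IsSimple P ↔ ComplexTorus.IsSimple P') :=
  haveI := isPrincipalIdealRing_ringOfIntegers_cyclotomicField_nine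
  isIsomorphic_iff_of_orderOf_eq_nine_or_eighteen (K := CyclotomicField 9 ℚ) hA hord hdim hA' hord' hdim'

set_option backward.isDefEq.respectTransparency false in -- see §1
/-- **THERE IS ONE SIMPLE `3`-DIMENSIONAL COMPLEX TORUS WITH AN AUTOMORPHISM OF ORDER `9` OR `18`** (the simple
`ζ_9`-threefold) — unconditionally. [cite: Shimura1998, §7.4 Prop. 17 p. 58, §8.4 Example (1) p. 65] [cite: BirkenhakeLange2004, §13.3]
[cite: Washington1997, Thm. 11.1] -/
theorem IsSimple.isIsomorphic_of_orderOf_eq_nine_or_eighteen' (hX : ComplexTorus.IsSimple P) {A : Matrix ι ι ℤ}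
    (hA : A ∈ endRingInt P) (hord : orderOf A = 9 ∨ orderOf A = 18) (hdim : finrank ℂ E = 3)
    (hX' : ComplexTorus.IsSimple P') {A' : Matrix ι' ι' ℤ} (hA' : A' ∈ endRingInt P')
    (hord' : orderOf A' = 9 ∨ orderOf A' = 18) (hdim' : finrank ℂ E' = 3) : IsIsomorphic P P' :=
  haveI := isPrincipalIdealRing_ringOfIntegers_cyclotomicField_nine
  hX.isIsomorphic_of_orderOf_eq_nine_or_eighteen (K := CyclotomicField 9 ℚ) hA hord hdim hX' hA' hord' hdim'

set_option backward.isDefEq.respectTransparency false in -- see §1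
/-- **All non-simple `3`-dimensional complex tori with an automorphism of order `9` or `18` are isomorphic** —
unconditionally. [cite: Shimura1998, §7.4 Prop. 17 p. 58, §8.4 Example (1) p. 65] [cite: BirkenhakeLange2004, §13.3] -/
theorem isIsomorphic_of_not_isSimple_of_orderOf_eq_nine_or_eighteen (hX : ¬ ComplexTorus.IsSimple P)
    {A : Matrix ι ι ℤ} (hA : A ∈ endRingInt P) (hord : orderOf A = 9 ∨ orderOf A = 18) (hdim : finrank ℂ E = 3)
    (hX' : ¬ ComplexTorus.IsSimple P') {A' : Matrix ι' ι' ℤ} (hA' : A' ∈ endRingInt P')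
    (hord' : orderOf A' = 9 ∨ orderOf A' = 18) (hdim' : finrank ℂ E' = 3) : IsIsomorphic P P' :=
  (isIsomorphic_iff_isSimple_iff_of_orderOf_eq_nine_or_eighteen hA hord hdim hA' hord' hdim').2 (iff_of_false hX hX')

set_option backward.isDefEq.respectTransparency false in -- see §1
/-- **EXACTLY TWO COMPLEX TORI OF DIMENSION `3` ADMIT AN AUTOMORPHISM OF ORDER `9`**: two non-isomorphic models
`X₁ = ℂ³/Φ₁(𝓞)` (simple), `X₂ = ℂ³/Φ₂(𝓞)` (non-simple) over `CyclotomicField 9 ℚ` such that every `3`-dimensional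
complex torus with an endomorphism of order `9` is isomorphic to `X₁` or to `X₂` (`h(ℚ(ζ_9)) · 2 = 2`).
[cite: BirkenhakeLange2004, §13.3] [cite: Shimura1998, §6.1 Thm. 2 p. 41, §7.4 Prop. 17 p. 58, §8.4 Example (1) p. 65]
[cite: Washington1997, Thm. 11.1] -/
theorem exists_pair_forall_isIsomorphic_of_orderOf_eq_nine :
    ∃ Φ₁ Φ₂ : CMType (CyclotomicField 9 ℚ),
      ComplexTorus.IsSimple (periodIso Φ₁ (1 : (FractionalIdeal (𝓞 (CyclotomicField 9 ℚ))⁰ (CyclotomicField 9 ℚ))ˣ)) ∧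
      ¬ ComplexTorus.IsSimple (periodIso Φ₂ (1 : (FractionalIdeal (𝓞 (CyclotomicField 9 ℚ))⁰ (CyclotomicField 9 ℚ))ˣ)) ∧
      ¬ IsIsomorphic (periodIso Φ₁ (1 : (FractionalIdeal (𝓞 (CyclotomicField 9 ℚ))⁰ (CyclotomicField 9 ℚ))ˣ))
          (periodIso Φ₂ (1 : (FractionalIdeal (𝓞 (CyclotomicField 9 ℚ))⁰ (CyclotomicField 9 ℚ))ˣ)) ∧
      ∀ {ι : Type} [Fintype ι] [DecidableEq ι] {E : Type} [NormedAddCommGroup E] [NormedSpace ℂ E]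
        (P : (ι → ℝ) ≃L[ℝ] E) {A : Matrix ι ι ℤ}, A ∈ endRingInt P → orderOf A = 9 → finrank ℂ E = 3 →
        IsIsomorphic P (periodIso Φ₁ (1 : (FractionalIdeal (𝓞 (CyclotomicField 9 ℚ))⁰ (CyclotomicField 9 ℚ))ˣ)) ∨
          IsIsomorphic P (periodIso Φ₂ (1 : (FractionalIdeal (𝓞 (CyclotomicField 9 ℚ))⁰ (CyclotomicField 9 ℚ))ˣ)) := by
  haveI := isPrincipalIdealRing_ringOfIntegers_cyclotomicField_nine
  have hζ := IsCyclotomicExtension.zeta_spec 9 ℚ (CyclotomicField 9 ℚ)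
  obtain ⟨Φ₁, Φ₂, h₁, h₂⟩ := exists_isSimple_and_not_isSimple_periodIso_nine (K := CyclotomicField 9 ℚ) 1
  refine ⟨Φ₁, Φ₂, h₁, h₂, fun h ↦ h₂ (h.isSimple_iff.1 h₁), fun P A hA hord hdim ↦ ?_⟩
  by_cases hX : ComplexTorus.IsSimple P
  · exact Or.inl (isIsomorphic_periodIso_one_of_orderOf_eq_nine (CyclotomicField 9 ℚ) hζ Φ₁ hA hord hdim
      (iff_of_true hX h₁))
  · exact Or.inr (isIsomorphic_periodIso_one_of_orderOf_eq_nine (CyclotomicField 9 ℚ) hζ Φ₂ hA hord hdim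
      (iff_of_false hX h₂))

end Nine

end ComplexTorus

end Literature.Geometry.Kaehler

end
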